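import Summits.QuantumFields.BalabanUV.Beta.FP.SecondVarPolarisation
import Summits.QuantumFields.BalabanUV.Beta.D1BFx.SliceTransferJetsMixed

/-!
# `BalabanUV.Beta.FP.KktPolarisation` — road «FP» for binder row D1, ROUTE T: **POLARISING A TWO-TERM FINITE-`j` LAW STATED ON BORDERED (SLICED) 2-JETS**

WHAT.  `SecondVarPolarisation.mixedVar_comb_of_secondVar_comb` (p303861) turns a two-term relation `secondVar N = secondVar F + secondVar G` holding along the
three directions `h`, `h′`, `h + h′` into the two-bond relation `mixedVar N = mixedVar F + mixedVar G`, provided the jets along `h + h′` are PRESENTED as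
`N_b + N_b′` (first) and `N_bb + 2•N_bb′ + N_b′b′` (second).  The road's finite-`j` laws (`NestedStepLawTorusTransported` §2, T-β, zero defect: one-shot `=`
one-step `j` `+` one-step `j+1`) have jets that are BORDERED matrices `kkt Kₙ [Qₙ; 0]` (zero slice jets), and along `h + h′` the dictionary delivers the
form ∕ averaging tables as sums `K_b + K_b′`, `K_bb + 2•K_bb′ + K_b′b′` INSIDE the `kkt`.  This file is the [folklore] bookkeeping that moves the sums out:
§1 `kkt_polarised_zeroSlice` (bordered jets with zero slice jet are linear in (form, averaging) — road BF-x's `SliceTransferJetsMixed.kkt_fromRows_add ∕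
`kkt_fromRows_smul` (d1-p2 g4, p-landed) BY NAME, not restated);
§2 **`mixedVar_comb_of_secondVar_comb_kkt`** — p303861 for three systems whose first ∕ second jets are zero-slice bordered jets, the sum-direction
hypothesis stated with the sums INSIDE `kkt` (the shape three instances of the torus law produce), conclusion the `mixedVar` law for the bordered jets.
USE: the (STEP) door's two-bond kernels are `mixedVar`s; feed three instances of `secondVar_oneShot_nestedStepLaw_torus_transported_levelUp` (along `h`, `h′`,
`h + h′`, with the sum-direction tables displayed as sums ∕ polarised combinations) to §2.  No `def`, no `def … : Prop`, nothing cited, 0 sorry; 0 estimates.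

HONEST DEPENDENCY (page 1, mandatory): continuum YM on T⁴ ⇐ BetaPertH ∧ nine spine estimates (0/9 proved); BetaPertH ⇐ (D1) ∧ (D4) ∧ CAP+tail;
G-an2-4 gates asym, D1 and NE2/3/4.  HONEST FRAMING (cell contract, verbatim): «discharging `BetaPertH` makes Bałaban's UV stability UNCONDITIONAL —
a real constructive-QFT result; it is NOT the continuum limit and NOT the Clay problem.»  ABSOLUTE RULE (cell charter, verbatim): «No internally-minted
statement may enter as a cited fact. Every hypothesis is either kernel-proved in this package or a verbatim quotation of a PUBLISHED theorem with page
reference. The manuscript(s) under audit are NOT citable for their own disputed steps — they are the thing under adjudication; programme-internal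
(2001/route/tribunal) claims are never citable.»  0∕4 row-D1 binders; NOT (T-ID), NOT SDF, NOT D1, NOT BetaPertH, NOT continuum, NOT Clay.
Road «FP» OWNER, b2b-balaban-beta-d1-p3 gen 18, 2026-08-22.  No existing file touched.
-/

noncomputable section

namespace Summit.QuantumFields.BalabanUV.Beta.FP.KktPolarisation

open Matrix
open Literature.MathematicalPhysics.QuantumFieldTheory.Balaban1983to89.Beta.Composition (kkt)
open Summit.QuantumFields.BalabanUV.Beta.D1BFx.LogDetSecondVariation (secondVar)
open Summit.QuantumFields.BalabanUV.Beta.FP.SecondVarPolarisation (mixedVar mixedVar_comb_of_secondVar_comb)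
open Summit.QuantumFields.BalabanUV.Beta.D1BFx.SliceTransferJetsMixed (kkt_fromRows_add kkt_fromRows_smul)

/-! ## §1 The polarised second bordered jet (linearity = road BF-x's `kkt_fromRows_add ∕ _smul`, by name) -/

section Linear

variable {ν κ ρ : Type*}

/-- [folklore] THE POLARISED SECOND BORDERED JET: `kkt (K_bb + 2•K_bb′ + K_b′b′) [Q_bb + 2•Q_bb′ + Q_b′b′; 0] = kkt K_bb [Q_bb;0] + 2 • kkt K_bb′ [Q_bb′;0] + kkt K_b′b′ [Q_b′b′;0]`. -/
theorem kkt_polarised_zeroSlice (Kbb Kbb' Kb'b' : Matrix ν ν ℝ) (Qbb Qbb' Qb'b' : Matrix κ ν ℝ) :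
    kkt (Kbb + (2 : ℝ) • Kbb' + Kb'b') (fromRows (Qbb + (2 : ℝ) • Qbb' + Qb'b') (0 : Matrix ρ ν ℝ))
      = kkt Kbb (fromRows Qbb (0 : Matrix ρ ν ℝ)) + (2 : ℝ) • kkt Kbb' (fromRows Qbb' (0 : Matrix ρ ν ℝ)) + kkt Kb'b' (fromRows Qb'b' (0 : Matrix ρ ν ℝ)) := by
  rw [kkt_fromRows_add, kkt_fromRows_add, kkt_fromRows_smul]

end Linear

/-! ## §2 Polarisation of a two-term law on bordered jets -/

section Polarise

variable {ν₁ κ₁ ρ₁ ν₂ κ₂ ρ₂ ν₃ κ₃ ρ₃ : Type*}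
  [Fintype ν₁] [Fintype κ₁] [Fintype ρ₁] [DecidableEq ν₁] [DecidableEq κ₁] [DecidableEq ρ₁]
  [Fintype ν₂] [Fintype κ₂] [Fintype ρ₂] [DecidableEq ν₂] [DecidableEq κ₂] [DecidableEq ρ₂]
  [Fintype ν₃] [Fintype κ₃] [Fintype ρ₃] [DecidableEq ν₃] [DecidableEq κ₃] [DecidableEq ρ₃]

/-- [folklore] **A TWO-TERM LAW ON ZERO-SLICE BORDERED 2-JETS ALONG `h`, `h′`, `h + h′` POLARISES.**  Three systems — `N` (base point `N₀`, e.g. the one-shot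
literal's sliced system), `F` (base `F₀`, e.g. the fine one-step sliced system), `G` (base `G₀`, e.g. the level-`(j+1)` sliced system) — with first ∕ second
jets along the two directions given as bordered matrices `kkt K_b [Q_b; 0]`, `kkt K_bb [Q_bb; 0]` etc., and the jets along the SUM direction delivered with the
sums INSIDE the border: `kkt (K_b + K_b′) [Q_b + Q_b′; 0]`, `kkt (K_bb + 2•K_bb′ + K_b′b′) [Q_bb + 2•Q_bb′ + Q_b′b′; 0]`.  If `secondVar N = secondVar F + secondVar G`
holds along each of the three directions, then `mixedVar N = mixedVar F + mixedVar G` for the two-bond (mixed) bordered jets. -/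
theorem mixedVar_comb_of_secondVar_comb_kkt
    (N₀ : Matrix (ν₁ ⊕ (κ₁ ⊕ ρ₁)) (ν₁ ⊕ (κ₁ ⊕ ρ₁)) ℝ) (Nb Nb' Nbb Nb'b' Nbb' : Matrix ν₁ ν₁ ℝ) (Mb Mb' Mbb Mb'b' Mbb' : Matrix κ₁ ν₁ ℝ)
    (F₀ : Matrix (ν₂ ⊕ (κ₂ ⊕ ρ₂)) (ν₂ ⊕ (κ₂ ⊕ ρ₂)) ℝ) (Fb Fb' Fbb Fb'b' Fbb' : Matrix ν₂ ν₂ ℝ) (Eb Eb' Ebb Eb'b' Ebb' : Matrix κ₂ ν₂ ℝ)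
    (G₀ : Matrix (ν₃ ⊕ (κ₃ ⊕ ρ₃)) (ν₃ ⊕ (κ₃ ⊕ ρ₃)) ℝ) (Gb Gb' Gbb Gb'b' Gbb' : Matrix ν₃ ν₃ ℝ) (Rb Rb' Rbb Rb'b' Rbb' : Matrix κ₃ ν₃ ℝ)
    (hb : secondVar N₀ (kkt Nb (fromRows Mb (0 : Matrix ρ₁ ν₁ ℝ))) (kkt Nbb (fromRows Mbb (0 : Matrix ρ₁ ν₁ ℝ)))
      = secondVar F₀ (kkt Fb (fromRows Eb (0 : Matrix ρ₂ ν₂ ℝ))) (kkt Fbb (fromRows Ebb (0 : Matrix ρ₂ ν₂ ℝ)))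
        + secondVar G₀ (kkt Gb (fromRows Rb (0 : Matrix ρ₃ ν₃ ℝ))) (kkt Gbb (fromRows Rbb (0 : Matrix ρ₃ ν₃ ℝ))))
    (hb' : secondVar N₀ (kkt Nb' (fromRows Mb' (0 : Matrix ρ₁ ν₁ ℝ))) (kkt Nb'b' (fromRows Mb'b' (0 : Matrix ρ₁ ν₁ ℝ)))
      = secondVar F₀ (kkt Fb' (fromRows Eb' (0 : Matrix ρ₂ ν₂ ℝ))) (kkt Fb'b' (fromRows Eb'b' (0 : Matrix ρ₂ ν₂ ℝ)))
        + secondVar G₀ (kkt Gb' (fromRows Rb' (0 : Matrix ρ₃ ν₃ ℝ))) (kkt Gb'b' (fromRows Rb'b' (0 : Matrix ρ₃ ν₃ ℝ))))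
    (hsum : secondVar N₀ (kkt (Nb + Nb') (fromRows (Mb + Mb') (0 : Matrix ρ₁ ν₁ ℝ)))
        (kkt (Nbb + (2 : ℝ) • Nbb' + Nb'b') (fromRows (Mbb + (2 : ℝ) • Mbb' + Mb'b') (0 : Matrix ρ₁ ν₁ ℝ)))
      = secondVar F₀ (kkt (Fb + Fb') (fromRows (Eb + Eb') (0 : Matrix ρ₂ ν₂ ℝ)))
          (kkt (Fbb + (2 : ℝ) • Fbb' + Fb'b') (fromRows (Ebb + (2 : ℝ) • Ebb' + Eb'b') (0 : Matrix ρ₂ ν₂ ℝ)))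
        + secondVar G₀ (kkt (Gb + Gb') (fromRows (Rb + Rb') (0 : Matrix ρ₃ ν₃ ℝ)))
          (kkt (Gbb + (2 : ℝ) • Gbb' + Gb'b') (fromRows (Rbb + (2 : ℝ) • Rbb' + Rb'b') (0 : Matrix ρ₃ ν₃ ℝ)))) :
    mixedVar N₀ (kkt Nb (fromRows Mb (0 : Matrix ρ₁ ν₁ ℝ))) (kkt Nb' (fromRows Mb' (0 : Matrix ρ₁ ν₁ ℝ))) (kkt Nbb' (fromRows Mbb' (0 : Matrix ρ₁ ν₁ ℝ)))
      = mixedVar F₀ (kkt Fb (fromRows Eb (0 : Matrix ρ₂ ν₂ ℝ))) (kkt Fb' (fromRows Eb' (0 : Matrix ρ₂ ν₂ ℝ))) (kkt Fbb' (fromRows Ebb' (0 : Matrix ρ₂ ν₂ ℝ)))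
        + mixedVar G₀ (kkt Gb (fromRows Rb (0 : Matrix ρ₃ ν₃ ℝ))) (kkt Gb' (fromRows Rb' (0 : Matrix ρ₃ ν₃ ℝ))) (kkt Gbb' (fromRows Rbb' (0 : Matrix ρ₃ ν₃ ℝ))) := by
  rw [kkt_polarised_zeroSlice, kkt_polarised_zeroSlice, kkt_polarised_zeroSlice, kkt_fromRows_add, kkt_fromRows_add, kkt_fromRows_add] at hsum
  exact mixedVar_comb_of_secondVar_comb N₀ _ _ _ _ _ F₀ _ _ _ _ _ G₀ _ _ _ _ _ hb hb' hsum

end Polarise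

/-! ## §3 (v1.1 APPEND, gen 19) The same for GRADED first jets — the (−)-placed bordered jet is linear in (form, averaging) too -/

section Graded

variable {ν κ ρ : Type*}

/-- [folklore] THE (−)-PLACED ZERO-SLICE BORDERED JET IS ADDITIVE in (form, averaging):
`[[K + K′, −[Q + Q′; 0]ᵀ], [[Q + Q′; 0], 0]] = [[K, −[Q;0]ᵀ],[[Q;0], 0]] + [[K′, −[Q′;0]ᵀ],[[Q′;0], 0]]`. -/
theorem signTwist_zeroSlice_add (K K' : Matrix ν ν ℝ) (Q Q' : Matrix κ ν ℝ) :
    fromBlocks (K + K') (-(fromRows (Q + Q') (0 : Matrix ρ ν ℝ))ᵀ) (fromRows (Q + Q') (0 : Matrix ρ ν ℝ)) 0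
      = fromBlocks K (-(fromRows Q (0 : Matrix ρ ν ℝ))ᵀ) (fromRows Q (0 : Matrix ρ ν ℝ)) 0
        + fromBlocks K' (-(fromRows Q' (0 : Matrix ρ ν ℝ))ᵀ) (fromRows Q' (0 : Matrix ρ ν ℝ)) 0 := by
  have h : fromRows (Q + Q') (0 : Matrix ρ ν ℝ) = fromRows Q (0 : Matrix ρ ν ℝ) + fromRows Q' (0 : Matrix ρ ν ℝ) := by
    ext i j; rcases i with i | i <;> simp
  rw [h, Matrix.fromBlocks_add, Matrix.transpose_add, neg_add, add_zero]

end Graded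

section PolariseGraded

variable {ν₁ κ₁ ρ₁ ν₂ κ₂ ρ₂ ν₃ κ₃ ρ₃ : Type*}
  [Fintype ν₁] [Fintype κ₁] [Fintype ρ₁] [DecidableEq ν₁] [DecidableEq κ₁] [DecidableEq ρ₁]
  [Fintype ν₂] [Fintype κ₂] [Fintype ρ₂] [DecidableEq ν₂] [DecidableEq κ₂] [DecidableEq ρ₂]
  [Fintype ν₃] [Fintype κ₃] [Fintype ρ₃] [DecidableEq ν₃] [DecidableEq κ₃] [DecidableEq ρ₃]

/-- [folklore] **A TWO-TERM LAW ON GRADED ZERO-SLICE BORDERED 2-JETS ALONG `h`, `h′`, `h + h′` POLARISES** — the graded twin of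
`mixedVar_comb_of_secondVar_comb_kkt` for the laws of `NestedStepLawTorusTransportedGraded` (R-FP-54′): the FIRST jets are the (−)-PLACED bordered jets
`[[K_b, −[Q_b;0]ᵀ],[[Q_b;0], 0]]` (odd objects sign-twisted), the SECOND jets the ordinary `kkt K_bb [Q_bb; 0]`; along the SUM direction the sums sit INSIDE the
blocks.  If `secondVar N = secondVar F + secondVar G` holds along each of the three directions, then `mixedVar N = mixedVar F + mixedVar G` for the two-bond jets. -/
theorem mixedVar_comb_of_secondVar_comb_kkt_graded
    (N₀ : Matrix (ν₁ ⊕ (κ₁ ⊕ ρ₁)) (ν₁ ⊕ (κ₁ ⊕ ρ₁)) ℝ) (Nb Nb' Nbb Nb'b' Nbb' : Matrix ν₁ ν₁ ℝ) (Mb Mb' Mbb Mb'b' Mbb' : Matrix κ₁ ν₁ ℝ)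
    (F₀ : Matrix (ν₂ ⊕ (κ₂ ⊕ ρ₂)) (ν₂ ⊕ (κ₂ ⊕ ρ₂)) ℝ) (Fb Fb' Fbb Fb'b' Fbb' : Matrix ν₂ ν₂ ℝ) (Eb Eb' Ebb Eb'b' Ebb' : Matrix κ₂ ν₂ ℝ)
    (G₀ : Matrix (ν₃ ⊕ (κ₃ ⊕ ρ₃)) (ν₃ ⊕ (κ₃ ⊕ ρ₃)) ℝ) (Gb Gb' Gbb Gb'b' Gbb' : Matrix ν₃ ν₃ ℝ) (Rb Rb' Rbb Rb'b' Rbb' : Matrix κ₃ ν₃ ℝ)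
    (hb : secondVar N₀ (fromBlocks Nb (-(fromRows Mb (0 : Matrix ρ₁ ν₁ ℝ))ᵀ) (fromRows Mb (0 : Matrix ρ₁ ν₁ ℝ)) 0) (kkt Nbb (fromRows Mbb (0 : Matrix ρ₁ ν₁ ℝ)))
      = secondVar F₀ (fromBlocks Fb (-(fromRows Eb (0 : Matrix ρ₂ ν₂ ℝ))ᵀ) (fromRows Eb (0 : Matrix ρ₂ ν₂ ℝ)) 0) (kkt Fbb (fromRows Ebb (0 : Matrix ρ₂ ν₂ ℝ)))
        + secondVar G₀ (fromBlocks Gb (-(fromRows Rb (0 : Matrix ρ₃ ν₃ ℝ))ᵀ) (fromRows Rb (0 : Matrix ρ₃ ν₃ ℝ)) 0) (kkt Gbb (fromRows Rbb (0 : Matrix ρ₃ ν₃ ℝ))))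
    (hb' : secondVar N₀ (fromBlocks Nb' (-(fromRows Mb' (0 : Matrix ρ₁ ν₁ ℝ))ᵀ) (fromRows Mb' (0 : Matrix ρ₁ ν₁ ℝ)) 0) (kkt Nb'b' (fromRows Mb'b' (0 : Matrix ρ₁ ν₁ ℝ)))
      = secondVar F₀ (fromBlocks Fb' (-(fromRows Eb' (0 : Matrix ρ₂ ν₂ ℝ))ᵀ) (fromRows Eb' (0 : Matrix ρ₂ ν₂ ℝ)) 0) (kkt Fb'b' (fromRows Eb'b' (0 : Matrix ρ₂ ν₂ ℝ)))
        + secondVar G₀ (fromBlocks Gb' (-(fromRows Rb' (0 : Matrix ρ₃ ν₃ ℝ))ᵀ) (fromRows Rb' (0 : Matrix ρ₃ ν₃ ℝ)) 0) (kkt Gb'b' (fromRows Rb'b' (0 : Matrix ρ₃ ν₃ ℝ))))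
    (hsum : secondVar N₀ (fromBlocks (Nb + Nb') (-(fromRows (Mb + Mb') (0 : Matrix ρ₁ ν₁ ℝ))ᵀ) (fromRows (Mb + Mb') (0 : Matrix ρ₁ ν₁ ℝ)) 0)
        (kkt (Nbb + (2 : ℝ) • Nbb' + Nb'b') (fromRows (Mbb + (2 : ℝ) • Mbb' + Mb'b') (0 : Matrix ρ₁ ν₁ ℝ)))
      = secondVar F₀ (fromBlocks (Fb + Fb') (-(fromRows (Eb + Eb') (0 : Matrix ρ₂ ν₂ ℝ))ᵀ) (fromRows (Eb + Eb') (0 : Matrix ρ₂ ν₂ ℝ)) 0)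
          (kkt (Fbb + (2 : ℝ) • Fbb' + Fb'b') (fromRows (Ebb + (2 : ℝ) • Ebb' + Eb'b') (0 : Matrix ρ₂ ν₂ ℝ)))
        + secondVar G₀ (fromBlocks (Gb + Gb') (-(fromRows (Rb + Rb') (0 : Matrix ρ₃ ν₃ ℝ))ᵀ) (fromRows (Rb + Rb') (0 : Matrix ρ₃ ν₃ ℝ)) 0)
          (kkt (Gbb + (2 : ℝ) • Gbb' + Gb'b') (fromRows (Rbb + (2 : ℝ) • Rbb' + Rb'b') (0 : Matrix ρ₃ ν₃ ℝ)))) :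
    mixedVar N₀ (fromBlocks Nb (-(fromRows Mb (0 : Matrix ρ₁ ν₁ ℝ))ᵀ) (fromRows Mb (0 : Matrix ρ₁ ν₁ ℝ)) 0)
        (fromBlocks Nb' (-(fromRows Mb' (0 : Matrix ρ₁ ν₁ ℝ))ᵀ) (fromRows Mb' (0 : Matrix ρ₁ ν₁ ℝ)) 0) (kkt Nbb' (fromRows Mbb' (0 : Matrix ρ₁ ν₁ ℝ)))
      = mixedVar F₀ (fromBlocks Fb (-(fromRows Eb (0 : Matrix ρ₂ ν₂ ℝ))ᵀ) (fromRows Eb (0 : Matrix ρ₂ ν₂ ℝ)) 0)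
          (fromBlocks Fb' (-(fromRows Eb' (0 : Matrix ρ₂ ν₂ ℝ))ᵀ) (fromRows Eb' (0 : Matrix ρ₂ ν₂ ℝ)) 0) (kkt Fbb' (fromRows Ebb' (0 : Matrix ρ₂ ν₂ ℝ)))
        + mixedVar G₀ (fromBlocks Gb (-(fromRows Rb (0 : Matrix ρ₃ ν₃ ℝ))ᵀ) (fromRows Rb (0 : Matrix ρ₃ ν₃ ℝ)) 0)
          (fromBlocks Gb' (-(fromRows Rb' (0 : Matrix ρ₃ ν₃ ℝ))ᵀ) (fromRows Rb' (0 : Matrix ρ₃ ν₃ ℝ)) 0) (kkt Gbb' (fromRows Rbb' (0 : Matrix ρ₃ ν₃ ℝ))) := by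
  rw [signTwist_zeroSlice_add, signTwist_zeroSlice_add, signTwist_zeroSlice_add, kkt_polarised_zeroSlice, kkt_polarised_zeroSlice,
    kkt_polarised_zeroSlice] at hsum
  exact mixedVar_comb_of_secondVar_comb N₀ _ _ _ _ _ F₀ _ _ _ _ _ G₀ _ _ _ _ _ hb hb' hsum

end PolariseGraded

/-! ## §4 (v1.2 APPEND, gen 19) Representatives at second order: the functionals are AFFINE in the second jet -/

section Transfer

variable {ι : Type*} [Fintype ι] [DecidableEq ι]

/-- [folklore] **`secondVar` IS AFFINE IN THE SECOND JET**: replacing `A₂` by a representative `A₂ + R` costs exactly the trace `tr(A₀⁻¹·R)` —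
so the road's laws may be fed REPRESENTATIVE second-order tables, the price being ONE trace-null row per system (W-FP-19-18 ∕ an2 Q-an2-g39-1: (TN) rows);
no such freedom at first order (quadratic).  (The `mixedVar` twin is d1-p2's `D1BFx.PackedWardLiftOddDrop.mixedVar_add_right`, already in the tree —
not restated here.) -/
theorem secondVar_add_right (A₀ A₁ A₂ R : Matrix ι ι ℝ) : secondVar A₀ A₁ (A₂ + R) = secondVar A₀ A₁ A₂ + (A₀⁻¹ * R).trace := by
  unfold secondVar
  rw [Matrix.mul_add, Matrix.trace_add]
  ring

/-- [folklore] **TRANSFER UNDER A TRACE-NULL REMAINDER**: if `tr(A₀⁻¹·R) = 0` the representative and the true second jet give the same `secondVar`. -/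
theorem secondVar_congr_right_of_trace_null (A₀ A₁ A₂ R : Matrix ι ι ℝ) (hR : (A₀⁻¹ * R).trace = 0) :
    secondVar A₀ A₁ (A₂ + R) = secondVar A₀ A₁ A₂ := by
  rw [secondVar_add_right, hR, add_zero]

end Transfer

section TransferBordered

variable {ν κ ρ : Type*} [Fintype ν] [Fintype κ] [Fintype ρ] [DecidableEq ν] [DecidableEq κ] [DecidableEq ρ]

/-- [folklore] **BORDERED FORM**: a remainder `(R, E)` on the second-order (form, averaging) tables of a zero-slice bordered second jet costs
`tr(N₀⁻¹ · kkt R [E; 0])` — the (TN) row of W-FP-19-18 for that system. -/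
theorem secondVar_kkt_add_right (N₀ : Matrix (ν ⊕ (κ ⊕ ρ)) (ν ⊕ (κ ⊕ ρ)) ℝ) (N₁ : Matrix (ν ⊕ (κ ⊕ ρ)) (ν ⊕ (κ ⊕ ρ)) ℝ)
    (K₂ R : Matrix ν ν ℝ) (Q₂ E : Matrix κ ν ℝ) :
    secondVar N₀ N₁ (kkt (K₂ + R) (fromRows (Q₂ + E) (0 : Matrix ρ ν ℝ)))
      = secondVar N₀ N₁ (kkt K₂ (fromRows Q₂ (0 : Matrix ρ ν ℝ))) + (N₀⁻¹ * kkt R (fromRows E (0 : Matrix ρ ν ℝ))).trace := by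
  rw [← secondVar_add_right, ← kkt_fromRows_add]

end TransferBordered

end Summit.QuantumFields.BalabanUV.Beta.FP.KktPolarisation

end
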